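import Summits.QuantumFields.BalabanUV.T4Continuum.Support.ShellMeasureLevelZeroBoxWitness

/-!
# `T4Continuum.ShellMeasureLevelZeroShellMass` — non-vacuity at level 0, MEASURE HALF: THE LIVE SHELL OF THE LEVEL-0 FACE HAS
# POSITIVE REALIZED MASS (so the certified (M1)₀ inequality is NOT trivially true)
(cell `pub-balaban`, sub-cell `t4`, spine estimate NE7c (node U5b); NE7c ROUND-2 crew, unit
`b2b-balaban-t4-ne7c-formalise-leaf-10` gen 11; row S89 f2 of the owner table `t4/b2b-balaban-t4-ne7c-p1/LEAVES-NE7c-P1.md`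
(S89 = rule G-1 retro-fit at level 0, f1 `ShellMeasureLevelZeroBoxWitness` p229619; the owner's S89 booking R-ne7cp1-g33-1 (b) notes
that f1 does NOT claim positive shell mass — this file supplies it); ADDITIVE — imports S89 f1 ONLY (hence the owner's S11
`ShellMeasureWilsonGaugeInvariant`, `T4ExpWindowSmallField`, `UnitaryModel`, `AveragingRT`); [folklore]; 0 `def`, 0 `def … : Prop`,
0 sorry, 0 citation tags)

HONEST FRAMING.  Finite four-torus programme, rung (B)+1 only — NOT infinite volume, NOT a mass gap, NOT the Clay
problem, NOT summit progress; (B), `BetaPertHyp`, (B^μ) not consumed.  NE7c (`T4IndicatorShell.ShellWeightBound`) is NOT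
PRINTED in [Balaban 1983–89] and NOT PROVED; «NE7c ⇐ the named binders».  (M1)₀ realized ≠ NE7c; the level-0 face serves
`K ≤ N₁` only.  This file is ELEMENTARY measure theory on OUR realized level-0 objects (product Haar on `SU(2)`, the gauge-invariant
density `giF`, the classifier `wilsonU`): nothing of Bałaban's, no estimate, nothing printed asserted or cited.  HONEST DEPENDENCY
(cell): continuum YM on T⁴ ⇐ BetaPertH ∧ nine spine estimates (0/9 proved); BetaPertH ⇐ (D1) ∧ (D4) ∧ CAP+tail; G-an2-4 gates
asym, D1 and NE2/3/4.

THE POINT.  (M1)₀ says `μ{θ(1−ρ) ≤ u < θ} ≤ D·ρ·μ(univ)`; it is trivially true when the shell is `μ`-null.  For the level-0 face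
(S11: `μ = (fieldMeasure P j SU2).withDensity (giF lo hi σ β P_w)`, `u = wilsonU` over a plaquette set `P_u`) we show the shell has
POSITIVE mass whenever `P_u` contains the corner plaquette `⟨castSite lo, i₀, i₁⟩` of a non-wrapping box with `lo + e_{i₀} + e_{i₁} ≤ hi`,
`0 < θ ≤ σ`, `θ ≤ 2`, `0 < ρ ≤ 1` (`shellMass_pos`).  Mechanism: §1 on `SU(2)` — `dist1` is continuous, `{dist1 < ε}` and
`{|dist1 − c| < ε}` are open, `dist1 (expPoint x) = 2|sin(‖x‖∕2)|` (`T4ExpWindowSmallField`) produces a group element of ANY prescribed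
`dist1 ∈ [0, 2]`, and the normalized Haar measure charges nonempty open sets; §2 a plaquette holonomy is within the sum of its four
letters' `dist1` of `1`, and the SECOND letter is within the other three + the holonomy of `1`; the four bonds of a plaquette are
pairwise distinct on a torus with `≥ 2` sites per direction; §3 the PRODUCT NEIGHBOURHOOD «bond `b₀ = ⟨castSite(lo + e_{i₀}), i₁⟩` within
`θρ∕16` of `dist1 = θ(1 − ρ∕2)`, every other bond within `θρ∕16` of `1`» lies inside the shell AND inside the box co-test, has product-Haar
mass `Π_b haar(N_b) > 0`, and the density is `≥ e^{−2β·#P_w}` on it; §4 **`levelZero_face_su2_live`**: at S89 f1's CONCRETE data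
(torus `toyParams`, corner `0`, side-2 box, `Λ := blockBonds`, `P_u := boxPlaqF`, `S = 10⁻⁴`, `σ = θ = 2·10⁻⁵`, `δ = ½`, `ρ = ¼`) the
face S11 FIRES (f1) AND its shell has POSITIVE realized mass — the level-0 (M1)₀ of record is non-vacuous in BOTH senses (hypotheses
jointly met on a nonempty block; conclusion not trivially true).  NOTHING in the countdown moves; NE7c NOT PROVED; spine 0∕9.
-/

noncomputable section

open Set Function MeasureTheory

namespace Summit.QuantumFields.BalabanUV.T4Continuum.ShellMeasureLevelZeroShellMass

open scoped ENNReal Matrix.Norms.L2Operator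
open Literature.MathematicalPhysics.QuantumFieldTheory.Balaban1983to89
open T4CubeChartGnomonic (SU2)
open T4AxialGaugeSmallField (castSite castSite_add_e castSite_injOn_box boxPlaqs)
open T4HaarSU2ExpChart (expPoint)
open T4ExpWindowSmallField (dist1_expPoint_eq)
open B7Prop1Explicit (e e_apply)
open ShellMeasureWilsonRealizedSU2 (wilsonU measurable_wilsonU)
open ShellMeasureWilsonGaugeInvariant (boxTest giF)
open ShellMeasureLevelZeroBoxWitness (blockBonds boxPlaqF mem_boxPlaqF toyParams toyParams_sitesPerDir dir_zero_lt_one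
  side_two_square side_two_nonwrapping levelZero_face_su2_inhabited e_apply_nonneg)

/-! ## §1 `SU(2)`: `dist1` is continuous, takes every value in `[0, 2]`, Haar charges open sets -/

section Group

/-- `dist1 = ‖· − 1‖_{op}` is continuous on `SU(2)` (`UnitaryModel.continuous_opDist1` through the inclusion). [folklore] -/
theorem continuous_dist1_su2 : Continuous (dist1 : SU2 → ℝ) := by
  show Continuous fun U : SU2 => UnitaryModel.opDist1 (U : Matrix (Fin 2) (Fin 2) ℂ)
  exact UnitaryModel.continuous_opDist1.comp continuous_subtype_val

/-- `{g | dist1 g < ε}` is open. [folklore] -/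
theorem isOpen_dist1_lt (ε : ℝ) : IsOpen {g : SU2 | dist1 g < ε} :=
  isOpen_lt continuous_dist1_su2 continuous_const

/-- `{g | |dist1 g − c| < ε}` is open. [folklore] -/
theorem isOpen_dist1_near (c ε : ℝ) : IsOpen {g : SU2 | |dist1 g - c| < ε} :=
  isOpen_lt (continuous_abs.comp (continuous_dist1_su2.sub continuous_const)) continuous_const

/-- EVERY value in `[0, 2]` is a `dist1`: `dist1 (expPoint x) = 2|sin(‖x‖∕2)|` at `‖x‖ = 2·arcsin(c∕2)`. [folklore] -/
theorem exists_dist1_eq {c : ℝ} (h0 : 0 ≤ c) (h2 : c ≤ 2) : ∃ g : SU2, dist1 g = c := by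
  refine ⟨expPoint (PiLp.single 2 (0 : Fin 3) (2 * Real.arcsin (c / 2))), ?_⟩
  have ha0 : 0 ≤ Real.arcsin (c / 2) := Real.arcsin_nonneg.2 (by linarith)
  have haπ : Real.arcsin (c / 2) ≤ Real.pi / 2 := Real.arcsin_le_pi_div_two _
  have hn : ‖(PiLp.single 2 (0 : Fin 3) (2 * Real.arcsin (c / 2)) : EuclideanSpace ℝ (Fin 3))‖ =
      2 * Real.arcsin (c / 2) := by
    rw [PiLp.norm_single, Real.norm_eq_abs, abs_of_nonneg (by linarith)]
  have hsin : 0 ≤ Real.sin (Real.arcsin (c / 2)) :=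
    Real.sin_nonneg_of_nonneg_of_le_pi ha0 (by linarith [Real.pi_pos])
  rw [dist1_expPoint_eq, hn, mul_div_cancel_left₀ _ (two_ne_zero), abs_of_nonneg hsin,
    Real.sin_arcsin (by linarith) (by linarith)]
  ring

/-- the normalized Haar measure of `SU(2)` charges every nonempty open set. [folklore] -/
theorem haar_pos_of_isOpen {V : Set SU2} (hV : IsOpen V) (hne : V.Nonempty) :
    0 < (HaarData.haar : Measure SU2) V := by
  haveI : (HaarData.haar : Measure SU2).IsOpenPosMeasure := by
    show (Measure.haarMeasure (⊤ : TopologicalSpace.PositiveCompacts SU2)).IsOpenPosMeasure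
    infer_instance
  exact hV.measure_pos _ hne

end Group

/-! ## §2 Plaquette holonomies against their letters -/

section Plaquette

variable {P : Params} {j : ℕ}

/-- the four bonds of a plaquette. [folklore] -/
theorem plaqHol_eq (U : GaugeField P j SU2) (p : Plaq P j) :
    GaugeField.plaqHol U p =
      U ⟨p.src, p.μ⟩ * U ⟨p.src.shift p.μ, p.ν⟩ * (U ⟨p.src.shift p.ν, p.μ⟩)⁻¹ * (U ⟨p.src, p.ν⟩)⁻¹ := rfl

/-- a plaquette holonomy is within the SUM of its four letters' `dist1` of `1`. [folklore] -/
theorem dist1_plaqHol_le (U : GaugeField P j SU2) (p : Plaq P j) :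
    dist1 (GaugeField.plaqHol U p) ≤ dist1 (U ⟨p.src, p.μ⟩) + dist1 (U ⟨p.src.shift p.μ, p.ν⟩) +
      dist1 (U ⟨p.src.shift p.ν, p.μ⟩) + dist1 (U ⟨p.src, p.ν⟩) := by
  rw [plaqHol_eq]
  calc dist1 (U ⟨p.src, p.μ⟩ * U ⟨p.src.shift p.μ, p.ν⟩ * (U ⟨p.src.shift p.ν, p.μ⟩)⁻¹ * (U ⟨p.src, p.ν⟩)⁻¹)
      ≤ dist1 (U ⟨p.src, p.μ⟩ * U ⟨p.src.shift p.μ, p.ν⟩ * (U ⟨p.src.shift p.ν, p.μ⟩)⁻¹) + dist1 ((U ⟨p.src, p.ν⟩)⁻¹) :=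
        GaugeGroup.dist1_mul_le _ _
    _ ≤ dist1 (U ⟨p.src, p.μ⟩ * U ⟨p.src.shift p.μ, p.ν⟩) + dist1 ((U ⟨p.src.shift p.ν, p.μ⟩)⁻¹) +
          dist1 ((U ⟨p.src, p.ν⟩)⁻¹) := by gcongr; exact GaugeGroup.dist1_mul_le _ _
    _ ≤ dist1 (U ⟨p.src, p.μ⟩) + dist1 (U ⟨p.src.shift p.μ, p.ν⟩) + dist1 ((U ⟨p.src.shift p.ν, p.μ⟩)⁻¹) +
          dist1 ((U ⟨p.src, p.ν⟩)⁻¹) := by gcongr; exact GaugeGroup.dist1_mul_le _ _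
    _ = _ := by rw [GaugeGroup.dist1_inv, GaugeGroup.dist1_inv]

/-- the SECOND letter is within «the other three letters + the holonomy» of `1`:
`U₂ = U₁⁻¹·U(∂p)·U₄·U₃`. [folklore] -/
theorem dist1_second_le (U : GaugeField P j SU2) (p : Plaq P j) :
    dist1 (U ⟨p.src.shift p.μ, p.ν⟩) ≤ dist1 (U ⟨p.src, p.μ⟩) + dist1 (GaugeField.plaqHol U p) +
      dist1 (U ⟨p.src, p.ν⟩) + dist1 (U ⟨p.src.shift p.ν, p.μ⟩) := by
  have hB : U ⟨p.src.shift p.μ, p.ν⟩ =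
      (U ⟨p.src, p.μ⟩)⁻¹ * GaugeField.plaqHol U p * U ⟨p.src, p.ν⟩ * U ⟨p.src.shift p.ν, p.μ⟩ := by
    rw [plaqHol_eq]; group
  calc dist1 (U ⟨p.src.shift p.μ, p.ν⟩)
      = dist1 ((U ⟨p.src, p.μ⟩)⁻¹ * GaugeField.plaqHol U p * U ⟨p.src, p.ν⟩ * U ⟨p.src.shift p.ν, p.μ⟩) := by
        rw [← hB]
    _ ≤ dist1 ((U ⟨p.src, p.μ⟩)⁻¹ * GaugeField.plaqHol U p * U ⟨p.src, p.ν⟩) + dist1 (U ⟨p.src.shift p.ν, p.μ⟩) :=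
        GaugeGroup.dist1_mul_le _ _
    _ ≤ dist1 ((U ⟨p.src, p.μ⟩)⁻¹ * GaugeField.plaqHol U p) + dist1 (U ⟨p.src, p.ν⟩) + dist1 (U ⟨p.src.shift p.ν, p.μ⟩) := by
        gcongr; exact GaugeGroup.dist1_mul_le _ _
    _ ≤ dist1 (U ⟨p.src, p.μ⟩)⁻¹ + dist1 (GaugeField.plaqHol U p) + dist1 (U ⟨p.src, p.ν⟩) +
          dist1 (U ⟨p.src.shift p.ν, p.μ⟩) := by gcongr; exact GaugeGroup.dist1_mul_le _ _
    _ = _ := by rw [GaugeGroup.dist1_inv]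

/-- one lattice step moves a site on a torus with at least two sites per direction. [folklore] -/
theorem shift_ne_self (h2 : 2 ≤ P.sitesPerDir j) (x : Site P j) (κ : Fin P.d) : x.shift κ ≠ x := by
  intro h
  have h1 : x κ + 1 = x κ := by
    have := congr_fun h κ
    rwa [Site.shift, Function.update_self] at this
  haveI : Fact (1 < P.sitesPerDir j) := ⟨h2⟩
  exact one_ne_zero (add_eq_left.1 h1)

/-- the four bonds of a plaquette are PAIRWISE DISTINCT (torus with `≥ 2` sites per direction): the two letters of direction `μ`
differ by the shift `e_ν`, the two of direction `ν` by `e_μ`. [folklore] -/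
theorem bonds_distinct (h2 : 2 ≤ P.sitesPerDir j) (p : Plaq P j) :
    (⟨p.src, p.μ⟩ : PBond P j) ≠ ⟨p.src.shift p.μ, p.ν⟩ ∧ (⟨p.src, p.μ⟩ : PBond P j) ≠ ⟨p.src.shift p.ν, p.μ⟩ ∧
    (⟨p.src, p.μ⟩ : PBond P j) ≠ ⟨p.src, p.ν⟩ ∧ (⟨p.src.shift p.μ, p.ν⟩ : PBond P j) ≠ ⟨p.src.shift p.ν, p.μ⟩ ∧
    (⟨p.src.shift p.μ, p.ν⟩ : PBond P j) ≠ ⟨p.src, p.ν⟩ ∧ (⟨p.src.shift p.ν, p.μ⟩ : PBond P j) ≠ ⟨p.src, p.ν⟩ := by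
  have hμν : p.μ ≠ p.ν := ne_of_lt p.hμν
  refine ⟨?_, ?_, ?_, ?_, ?_, ?_⟩
  · intro h; exact hμν (congrArg PBond.dir h)
  · intro h; exact shift_ne_self h2 p.src p.ν (congrArg PBond.src h).symm
  · intro h; exact hμν (congrArg PBond.dir h)
  · intro h; exact hμν (congrArg PBond.dir h).symm
  · intro h; exact shift_ne_self h2 p.src p.μ (congrArg PBond.src h)
  · intro h; exact hμν (congrArg PBond.dir h)

/-- **LETTER BOOKKEEPING**: if every bond `b ≠ b₀` has `dist1 (U b) < ε` and `dist1 (U b₀) < c + ε` (`0 ≤ c`), then the four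
letters of ANY plaquette sum to `< c + 4ε` — `b₀` occurs at most once among four pairwise distinct bonds. [folklore] -/
theorem sum_letters_lt (h2 : 2 ≤ P.sitesPerDir j) {U : GaugeField P j SU2} {b₀ : PBond P j} {c ε : ℝ} (hc : 0 ≤ c)
    (hε : ∀ b, b ≠ b₀ → dist1 (U b) < ε) (h₀ : dist1 (U b₀) < c + ε) (p : Plaq P j) :
    dist1 (U ⟨p.src, p.μ⟩) + dist1 (U ⟨p.src.shift p.μ, p.ν⟩) + dist1 (U ⟨p.src.shift p.ν, p.μ⟩) +
      dist1 (U ⟨p.src, p.ν⟩) < c + 4 * ε := by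
  obtain ⟨h12, h13, h14, h23, h24, h34⟩ := bonds_distinct h2 p
  -- every letter is `< c + ε`, a letter `≠ b₀` is `< ε`
  have hany : ∀ b, dist1 (U b) < c + ε := fun b => by
    by_cases hb : b = b₀
    · rw [hb]; exact h₀
    · exact (hε b hb).trans_le (by linarith)
  by_cases e1 : (⟨p.src, p.μ⟩ : PBond P j) = b₀
  · have := hε _ (e1 ▸ h12.symm); have := hε _ (e1 ▸ h13.symm); have := hε _ (e1 ▸ h14.symm)
    linarith [hany ⟨p.src, p.μ⟩]
  by_cases e2 : (⟨p.src.shift p.μ, p.ν⟩ : PBond P j) = b₀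
  · have := hε _ (e2 ▸ h23.symm); have := hε _ (e2 ▸ h24.symm)
    linarith [hany ⟨p.src.shift p.μ, p.ν⟩, hε _ e1]
  by_cases e3 : (⟨p.src.shift p.ν, p.μ⟩ : PBond P j) = b₀
  · have := hε _ (e3 ▸ h34.symm)
    linarith [hany ⟨p.src.shift p.ν, p.μ⟩, hε _ e1, hε _ e2]
  linarith [hany ⟨p.src, p.ν⟩, hε _ e1, hε _ e2, hε _ e3]

end Plaquette

/-! ## §3 The shell of the level-0 face has positive realized mass -/

section Mass

variable {P : Params} {j : ℕ} [DecidableEq (PBond P j)]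

/-- **THE LIVE SHELL OF THE LEVEL-0 FACE HAS POSITIVE REALIZED MASS.**  Box `[lo, hi]` on `T^{(j)}`, NON-WRAPPING (`hN`), containing
the unit square `lo + e_{i₀} + e_{i₁} ≤ hi` (`i₀ < i₁`); classifier plaquettes `P_u ∋ ⟨castSite lo, i₀, i₁⟩`; numbers `0 < θ ≤ σ`,
`θ ≤ 2`, `0 < ρ ≤ 1`, `0 ≤ β`, any `P_w`.  Then the realized measure `(fieldMeasure P j SU2).withDensity (giF lo hi σ β P_w)` of S11
gives the shell `{θ(1−ρ) ≤ wilsonU < θ}` POSITIVE mass: the product neighbourhood «`b₀ := ⟨castSite(lo + e_{i₀}), i₁⟩` within `θρ∕16` of a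
group element of `dist1 = θ(1 − ρ∕2)`, all other bonds within `θρ∕16` of `1`» lies in the shell (§2: `wilsonU ∈ (θ(1 − 3ρ∕4), θ(1 − ρ∕4))`)
and in the co-test (every plaquette `< θ ≤ σ`), carries product-Haar mass `Π_b haar(N_b) > 0` (§1), and the density is `≥ e^{−2β·#P_w}`
there. [folklore] -/
theorem shellMass_pos {lo hi : Fin P.d → ℤ} (hN : ∀ κ, hi κ - lo κ < P.sitesPerDir j) {i₀ i₁ : Fin P.d} (h01 : i₀ < i₁)
    (hsq : lo + e i₀ + e i₁ ≤ hi) {Pu : Finset (Plaq P j)} (hPu : Pu.Nonempty)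
    (hp₀ : (⟨castSite lo, i₀, i₁, h01⟩ : Plaq P j) ∈ Pu) {σ θ ρ β : ℝ} (hθ : 0 < θ) (hθσ : θ ≤ σ) (hθ2 : θ ≤ 2)
    (hρ : 0 < ρ) (hρ1 : ρ ≤ 1) (hβ : 0 ≤ β) (Pw : Finset (Plaq P j)) :
    0 < ((fieldMeasure P j SU2).withDensity (giF lo hi σ β Pw))
      {U | θ * (1 - ρ) ≤ wilsonU hPu U ∧ wilsonU hPu U < θ} := by
  classical
  -- at least two sites per direction (the box has two distinct points in direction `i₀`)
  have h2 : 2 ≤ P.sitesPerDir j := by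
    have h := hN i₀
    have hs := hsq i₀
    have h10 : e i₀ i₀ = (1 : ℤ) := by rw [e_apply, if_pos rfl]
    have h20 : (0 : ℤ) ≤ e i₁ i₀ := e_apply_nonneg i₁ i₀
    simp only [Pi.add_apply] at hs
    omega
  -- the numbers
  set c : ℝ := θ * (1 - ρ / 2) with hc
  set ε : ℝ := θ * ρ / 16 with hε
  have hc0 : 0 ≤ c := by rw [hc]; nlinarith
  have hc2 : c ≤ 2 := by rw [hc]; nlinarith
  have hε0 : 0 < ε := by rw [hε]; positivity
  -- the distinguished bond, plaquette, group element
  set b₀ : PBond P j := ⟨castSite (lo + e i₀), i₁⟩ with hb₀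
  set p₀ : Plaq P j := ⟨castSite lo, i₀, i₁, h01⟩ with hp₀def
  obtain ⟨g₀, hg₀⟩ := exists_dist1_eq hc0 hc2
  -- the product neighbourhood
  set Nb : PBond P j → Set SU2 := fun b => if b = b₀ then {g | |dist1 g - c| < ε} else {g | dist1 g < ε} with hNb
  set N : Set (GaugeField P j SU2) := Set.pi Set.univ Nb with hNdef
  have hNb_open : ∀ b, IsOpen (Nb b) := fun b => by
    simp only [hNb]; split_ifs
    · exact isOpen_dist1_near c ε
    · exact isOpen_dist1_lt ε
  have hNb_ne : ∀ b, (Nb b).Nonempty := fun b => by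
    simp only [hNb]; split_ifs
    · exact ⟨g₀, by simp [hg₀, hε0]⟩
    · exact ⟨1, by simp [GaugeGroup.dist1_one, hε0]⟩
  -- letters on `N`
  have hletters : ∀ U ∈ N, (∀ b, b ≠ b₀ → dist1 (U b) < ε) ∧ |dist1 (U b₀) - c| < ε := by
    intro U hU
    have hU' : ∀ b, U b ∈ Nb b := fun b => hU b (Set.mem_univ _)
    refine ⟨fun b hb => ?_, ?_⟩
    · have := hU' b; simp only [hNb, if_neg hb, Set.mem_setOf_eq] at this; exact this
    · have := hU' b₀; simp only [hNb, if_pos rfl, Set.mem_setOf_eq] at this; exact this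
  -- every plaquette holonomy on `N` is `< c + 4ε = θ(1 − ρ/4) < θ`
  have hupper : ∀ U ∈ N, ∀ p : Plaq P j, dist1 (GaugeField.plaqHol U p) < θ := by
    intro U hU p
    obtain ⟨hε', h₀⟩ := hletters U hU
    have h₀' : dist1 (U b₀) < c + ε := by have := (abs_lt.1 h₀).2; linarith
    have := sum_letters_lt h2 hc0 hε' h₀' p
    have hcε : c + 4 * ε < θ := by rw [hc, hε]; nlinarith
    linarith [dist1_plaqHol_le U p]
  -- the distinguished plaquette's holonomy on `N` is `> c − 4ε = θ(1 − 3ρ/4) ≥ θ(1 − ρ)`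
  have hlower : ∀ U ∈ N, θ * (1 - ρ) < dist1 (GaugeField.plaqHol U p₀) := by
    intro U hU
    obtain ⟨hε', h₀⟩ := hletters U hU
    obtain ⟨h12, h13, h14, h23, h24, h34⟩ := bonds_distinct h2 p₀
    -- `b₀` is the second letter of `p₀`
    have hsecond : (⟨p₀.src.shift p₀.μ, p₀.ν⟩ : PBond P j) = b₀ := by
      simp only [hp₀def, hb₀, castSite_add_e]
    have hA := hε' ⟨p₀.src, p₀.μ⟩ (hsecond ▸ h12)
    have hC := hε' ⟨p₀.src.shift p₀.ν, p₀.μ⟩ (fun h => h23 (hsecond.trans h.symm))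
    have hD := hε' ⟨p₀.src, p₀.ν⟩ (fun h => h24 (hsecond.trans h.symm))
    have hB : c - ε < dist1 (U ⟨p₀.src.shift p₀.μ, p₀.ν⟩) := by
      rw [hsecond]; have := (abs_lt.1 h₀).1; linarith
    have hkey := dist1_second_le U p₀
    have hcε : θ * (1 - ρ) < c - 4 * ε := by rw [hc, hε]; nlinarith
    linarith
  -- `N ⊆ shell`
  have hNshell : N ⊆ {U | θ * (1 - ρ) ≤ wilsonU hPu U ∧ wilsonU hPu U < θ} := by
    intro U hU
    refine ⟨?_, ?_⟩
    · exact (hlower U hU).le.trans (Finset.le_sup' (fun p => dist1 (GaugeField.plaqHol U p)) hp₀)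
    · exact (Finset.sup'_lt_iff hPu).2 fun p _ => hupper U hU p
  -- the density on `N` is at least `κ := e^{−β·2·#P_w}`
  set κ : ℝ≥0∞ := ENNReal.ofReal (Real.exp (-(β * (2 * Pw.card)))) with hκ
  have hκ0 : κ ≠ 0 := by rw [hκ]; exact (ENNReal.ofReal_pos.2 (Real.exp_pos _)).ne'
  have hdens : ∀ U ∈ N, κ ≤ giF lo hi σ β Pw U := by
    intro U hU
    have hmem : U ∈ boxTest lo hi σ := fun p _ => (hupper U hU p).trans_le hθσ
    simp only [giF, Set.indicator_of_mem hmem, Pi.one_apply, one_mul, hκ]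
    refine ENNReal.ofReal_le_ofReal (Real.exp_le_exp.2 (neg_le_neg (mul_le_mul_of_nonneg_left ?_ hβ)))
    calc ∑ p ∈ Pw, (1 - reTr (GaugeField.plaqHol U p)) ≤ ∑ _p ∈ Pw, (2 : ℝ) :=
          Finset.sum_le_sum fun p _ => (RegularGaugeGroup.one_sub_reTr_mem_Icc _).2
      _ = 2 * Pw.card := by rw [Finset.sum_const, nsmul_eq_mul]; ring
  -- product-Haar mass of `N`
  have hNmeas : MeasurableSet N := MeasurableSet.univ_pi fun b => (hNb_open b).measurableSet
  have hNmass : 0 < fieldMeasure P j SU2 N := by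
    have hpi : fieldMeasure P j SU2 N = ∏ b, (HaarData.haar : Measure SU2) (Nb b) := by
      show Measure.pi (fun _ : PBond P j => (HaarData.haar : Measure SU2)) (Set.pi Set.univ Nb) = _
      exact Measure.pi_pi _ _
    rw [hpi]
    exact pos_iff_ne_zero.2 (Finset.prod_ne_zero_iff.2 fun b _ => (haar_pos_of_isOpen (hNb_open b) (hNb_ne b)).ne')
  -- assemble
  calc (0 : ℝ≥0∞) < κ * fieldMeasure P j SU2 N := ENNReal.mul_pos hκ0 hNmass.ne'
    _ = ∫⁻ _ in N, κ ∂(fieldMeasure P j SU2) := by rw [setLIntegral_const]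
    _ ≤ ∫⁻ U in N, giF lo hi σ β Pw U ∂(fieldMeasure P j SU2) := setLIntegral_mono' hNmeas fun U hU => hdens U hU
    _ = ((fieldMeasure P j SU2).withDensity (giF lo hi σ β Pw)) N := (withDensity_apply _ hNmeas).symm
    _ ≤ _ := measure_mono hNshell

end Mass

/-! ## §4 At S89 f1's concrete data: the face fires AND its shell has positive mass -/

section Concrete

open T4ShellMeasure (SlotAntiConcentration)

/-- **THE LEVEL-0 FACE OF RECORD IS NON-VACUOUS IN BOTH SENSES AT CONCRETE DATA**: on the torus `toyParams` (`d = 2`, six sites per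
direction), level `0`, corner `0`, side-2 box, `Λ := blockBonds 0 2` (nonempty, f1), `P_u := boxPlaqF 0 2`, numbers `S = 10⁻⁴`,
`σ = θ = 2·10⁻⁵`, `δ = ½`, `ρ = ¼`, every `β ≥ 0` and `P_w`: S11's (M1)₀ HOLDS (f1 `levelZero_face_su2_inhabited`) AND the shell
`{θ(1−ρ) ≤ wilsonU < θ}` has POSITIVE realized mass (§3 `shellMass_pos`). [folklore] -/
theorem levelZero_face_su2_live [DecidableEq (PBond toyParams 0)] {β : ℝ} (hβ : 0 ≤ β) (Pw : Finset (Plaq toyParams 0)) :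
    ∃ hPu : (boxPlaqF (P := toyParams) (j := 0) 0 (fun _ => (0 : ℤ) + 2)).Nonempty,
      SlotAntiConcentration
        ((fieldMeasure toyParams 0 SU2).withDensity (giF 0 (fun _ => (0 : ℤ) + 2) (2 / 10 ^ 5) β Pw))
        (wilsonU hPu) (2 / 10 ^ 5) (1 / 4)
        (2 * (((Fintype.card (↥(blockBonds (P := toyParams) (j := 0) 0 (fun _ => (0 : ℤ) + 2)) × Fin 3) : ℕ) : ℝ) +
          β * ∑ _p ∈ Pw, (8 * (1 / 10 ^ 4 : ℝ)) * (8 + 4 * (8 * (1 / 10 ^ 4 : ℝ)))) / (1 - 1 / 2)) ∧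
      0 < ((fieldMeasure toyParams 0 SU2).withDensity (giF 0 (fun _ => (0 : ℤ) + 2) (2 / 10 ^ 5) β Pw))
        {U | (2 / 10 ^ 5 : ℝ) * (1 - 1 / 4) ≤ wilsonU hPu U ∧ wilsonU hPu U < 2 / 10 ^ 5} := by
  obtain ⟨-, hPu, -, hM1⟩ := levelZero_face_su2_inhabited hβ Pw
  have hd : 2 ≤ toyParams.d := le_rfl
  have h3 : 3 ≤ toyParams.sitesPerDir 0 := by rw [toyParams_sitesPerDir]; norm_num
  have h01 := dir_zero_lt_one hd
  have hsq := side_two_square (P := toyParams) (0 : Fin toyParams.d → ℤ) _ _ h01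
  have hN := side_two_nonwrapping (j := 0) h3 (0 : Fin toyParams.d → ℤ)
  have hp₀ : (⟨castSite 0, _, _, h01⟩ : Plaq toyParams 0) ∈ boxPlaqF (P := toyParams) (j := 0) 0 (fun _ => (0 : ℤ) + 2) :=
    mem_boxPlaqF.2 ⟨0, le_rfl, hsq, rfl⟩
  exact ⟨hPu, hM1, shellMass_pos hN h01 hsq hPu hp₀ (by norm_num) le_rfl (by norm_num) (by norm_num) (by norm_num) hβ Pw⟩

end Concrete

end Summit.QuantumFields.BalabanUV.T4Continuum.ShellMeasureLevelZeroShellMass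

end
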